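/-
Copyright (c) 2026. All rights reserved.
Released under Apache 2.0 license as described in the file LICENSE.
Authors: abc-iut cell, prover seat abc-iut-w5-d038 (gen 8; row «ARC-MTC-F3» (L4-lead m134), part F3b″: the NO-GO side
of the archimedean `η⊢_{v,ν}` of [AbsTopIII] Cor 5.10 (iv)(c) — it cannot be natural with respect to a morphism whose
transition automorphism is complex conjugation; instance: the print-faithful RC-holomorphic geometric `EA`).
-/
import Literature.AnabelianGeometry.AbsoluteAnabelian.ArchimedeanHolGroupPairsEtaTimes
import Literature.AnabelianGeometry.AbsoluteAnabelian.ArchimedeanHolFieldFunctorGeometricRC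
import HarnessLib

/-!
# No natural `η⊢` across an orientation-reversing morphism ([AbsTopIII] Cor 5.10 (iv)(c), Rmk 5.8.1 (i); model level)

S. Mochizuki, *Topics in absolute anabelian geometry III*, Cor 5.10 (iv)(c) p. 148 l. 10–37, VERBATIM (v2, referee lane
L14-n6; arrow labels `λ⊞_{v,ν}`, `φ^{An⊢⊞}_{v,ν}` and the clause on `D•_{≤5}`/`D⊢` dropped at «…»): «there is a natural
isomorphism `η⊢_{v,ν}` from the composite functor determined by the path `γ¹_{v,ν}` [of length 6] `𝒳 → 𝒩⊞_v → 𝒩_v → ℰ• →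
ℰ⊢ → An⊢[𝒩⊢⊞] → 𝒩⊢⊞_v` … to the composite functor determined by the path `γ⁰_{v,ν}` [of length 2] `𝒳 → 𝒩⊞_v → 𝒩⊢⊞_v`»;
Prop 5.8 (iv)/(v) p. 140 (`k∼(G) = C∼ × C∼`, `k×(G) = C× × C∼`, «functorial [i.e., relative to TM⊢]»: a morphism of `TM⊢`
acts on BOTH factors through its lift to the universal covering `C∼`), Def 5.6 (iv) p. 136 (the `TB⊞`-leg: `B′ = e⁻¹(iℝ)`,
`B″ = e⁻¹(ℝ)` pulled back along the Kummer structure), Rmk 5.8.1 (i) p. 142 (the transition automorphisms are `id` or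
complex conjugation).

THE OBSERVATION (model level, complementing abc-iut-w5-d038's POSITIVE files `ArchimedeanHolGroupPairsEta{,Times,Shell}`
and the cochain no-go `AutHolFieldFunctor.not_exists_cochain_of_sign_endo_eq_neg_one`, p487676).  Let `f : 𝕏 → 𝕏` be an
endomorphism of `EA` whose transition automorphism `e_𝕏 ∘ 𝒜_f ∘ e_𝕏⁻¹` is complex CONJUGATION (`ε_f = -1`), and let
`(𝕏 ↶ k)` be a `TF`-pair over `𝕏`.  Then `f` lifts to an endomorphism `φ` of `(𝕏 ↶ k)` (`exists_endo_over`: the field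
automorphism `κ⁻¹ ∘ 𝒜_f ∘ κ` of `k`), and along `φ`:
* the `TB⊞`-leg `λ⊞_ν(φ)^{TB⊞}` rescales `B″ = e⁻¹(ℝ)` by `a₂ = +1` (conjugation FIXES the real line; abc-iut-L4-t8's
  `toTBPlus_map_a₂`), whereas
* `k∼(G_φ)`, `k×(G_φ)` rescale their `B″ = 0 × C∼` by `a₂ = σ(G_φ) = ε_f = -1` (abc-iut-w6-d025's `kTildeMap`/`kTimesMap`,
  abc-iut-w5-d038's `sign_toTMMono_map_eq_transitionSign`).
Since the `B″`-rescaling of a composite is the product and the `B″`-rescaling of ANY morphism of `TB⊞` is NONZERO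
(`TBPlus.Hom.a₂_ne_zero`: a morphism killing `B″` cannot be onto a two-dimensional `B`), NO natural transformation between
the two composite functors `𝒳 ⥤ TB⊞` exists in EITHER direction, at EITHER cross vertex:

* ★ `HolTFPair.isEmpty_natTrans_tilde/_times` (and `…_symm`, and the `Iso` corollaries);
* ★★ `HolRS.RC.isEmpty_eta_natTrans` — INSTANCE: at abc-iut-w5-d226/L4-t10's PRINT-FAITHFUL geometric `EA` of Riemann
  surfaces with RC-holomorphic (holomorphic OR anti-holomorphic) finite étale morphisms (`geometricAutHolFieldFunctorRC Q`),
  as soon as `Q` admits an object with an anti-holomorphic endomorphism (e.g. the complex plane with `z ↦ z̄`,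
  `RC.exists_antihol_aut_complexPlane`), the archimedean `η⊢_{v,pre}` and `η⊢_{v,mult}` do NOT exist as natural
  transformations — in contrast with the holomorphic sub-model, where they exist unconditionally
  (`HolRS.nonempty_etaTilde_geometric`, `nonempty_etaTimes_geometric`).

READING (honest, no side taken; v2): in the tree's UN-COARSIFIED typing (`LogFrobeniusSetting`: `𝒩⊢⊞_v = TM⊢ × TB⊞`),
naturality of `η⊢_{v,ν}` in `(𝕏 ↶ k)` holds exactly on the orientation-coherent part of `EA` (an orientation cochain,
p487676/p491679).  PRINT coarsifies: `𝒩⊢⊞_w := Orb(𝒞^{hol⊢}_{TB⊞}) ×_{Orb(TM⊢),w} Th⊢[Z]` (Def 5.6 (iv) p. 136), morphisms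
of `Orb(−)` being ORBITS under automorphisms of the target (§0 p. 28) — and the obstruction found here IS a target
automorphism, the sign automorphism `(1, ε_φ)` of `k∼(G)`/`k×(G)`: `ArchimedeanHolGroupPairsEtaOrb` proves `η⊢` natural UP
TO it for every `𝔄` with no hypothesis.  So this no-go concerns the un-coarsified model only; it is not a claim about
print. PROOF-ONLY (0 definitions); refereed pre-IUT material; nothing here bears on the disputed [IUTchIII] Cor. 3.12;
typed ≠ proved ≠ refuted-in-print.
-/

set_option autoImplicit false

universe u

open CategoryTheory Complex

namespace Literature.AnabelianGeometry.AbsoluteAnabelian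

/-! ## §1. A morphism of `TB⊞` rescales `B′` and `B″` by NONZERO scalars -/

namespace TBPlus

variable {M N : TBPlus.{u}}

/-- **The `B″`-rescaling of a morphism of `TB⊞` is nonzero**: if `a₂ = 0` the morphism kills `B″`, so its image is
`c₁(ℝ) ⊊ B` (`B′ ∩ B″ = 0`, `B″` nonconstant near `0`), contradicting surjectivity. [cite: MochizukiAbsTopIII2015, Def 5.6 (i) p. 134] -/
theorem Hom.a₂_ne_zero (f : M ⟶ N) : f.a₂ ≠ 0 := by
  intro h
  obtain ⟨ε, hε, -, hinj⟩ := N.exists_injOn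
  have hrange : ∀ n : N.B, ∃ s : ℝ, n = N.c₁ s := by
    intro n
    obtain ⟨m, rfl⟩ := f.surjective n
    obtain ⟨p, rfl⟩ := M.add_surjective m
    refine ⟨f.a₁ * p.1, ?_⟩
    change f.toHom (M.c₁ p.1 + M.c₂ p.2) = _
    rw [map_add, f.map_c₁, f.map_c₂, h, zero_mul, map_zero, add_zero]
  obtain ⟨s, hs⟩ := hrange (N.c₂ (ε / 2))
  have h0 : N.c₁ s = 0 := N.add_injective s (ε / 2) hs.symm
  have h2 : N.c₂ (ε / 2) = N.c₂ 0 := by rw [hs, h0, map_zero]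
  have hmem : (ε / 2 : ℝ) ∈ Set.Ioo (-ε) ε := ⟨by linarith, by linarith⟩
  have hmem0 : (0 : ℝ) ∈ Set.Ioo (-ε) ε := ⟨by linarith, by linarith⟩
  have : (ε / 2 : ℝ) = 0 := hinj hmem hmem0 h2
  linarith

/-- **The `B′`-rescaling of a morphism of `TB⊞` is nonzero** (symmetrically). [cite: MochizukiAbsTopIII2015, Def 5.6 (i) p. 134] -/
theorem Hom.a₁_ne_zero (f : M ⟶ N) : f.a₁ ≠ 0 := by
  intro h
  obtain ⟨ε, hε, hinj, -⟩ := N.exists_injOn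
  have hrange : ∀ n : N.B, ∃ t : ℝ, n = N.c₂ t := by
    intro n
    obtain ⟨m, rfl⟩ := f.surjective n
    obtain ⟨p, rfl⟩ := M.add_surjective m
    refine ⟨f.a₂ * p.2, ?_⟩
    change f.toHom (M.c₁ p.1 + M.c₂ p.2) = _
    rw [map_add, f.map_c₁, f.map_c₂, h, zero_mul, map_zero, zero_add]
  obtain ⟨t, ht⟩ := hrange (N.c₁ (ε / 2))
  have h0 : N.c₁ (ε / 2) = 0 := N.add_injective (ε / 2) t ht
  have h2 : N.c₁ (ε / 2) = N.c₁ 0 := by rw [h0, map_zero]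
  have hmem : (ε / 2 : ℝ) ∈ Set.Ioo (-ε) ε := ⟨by linarith, by linarith⟩
  have hmem0 : (0 : ℝ) ∈ Set.Ioo (-ε) ε := ⟨by linarith, by linarith⟩
  have : (ε / 2 : ℝ) = 0 := hinj hmem hmem0 h2
  linarith

end TBPlus

/-! ## §2. Endomorphisms of `EA` lift to endomorphisms of `TF`-pairs -/

namespace HolTFPair

variable {𝔄 : AutHolFieldFunctor.{u}}

/-- **Every endomorphism `f` of `𝕏` lifts to an endomorphism of `(𝕏 ↶ k)`**: `φ_M := κ⁻¹ ∘ 𝒜_f ∘ κ` (a continuous field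
automorphism of `k`, compatible with the Kummer structure by construction). [cite: MochizukiAbsTopIII2015, Definition 4.1 (ii) p.102] -/
theorem exists_endo_over (x : HolTFPair 𝔄) (f : x.X ⟶ x.X) : ∃ φ : x ⟶ x, φ.base = f :=
  ⟨⟨f, (x.κ.trans ((𝔄.Amap f).trans x.κ.symm)).toRingHom,
    x.continuous_κ_symm.comp ((𝔄.continuous_Amap f).comp x.continuous_κ),
    fun m => by
      change x.κ (x.κ.symm (𝔄.Amap f (x.κ m))) = _
      rw [RingEquiv.apply_symm_apply]⟩, rfl⟩

/-! ## §3. No natural transformation across an endomorphism of transition sign `-1` -/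

section NoGo

variable (x : HolTFPair 𝔄) (f : x.X ⟶ x.X) (hf : AutHolFieldFunctor.transitionSign f = -1)
include hf

/-- ★ **No natural transformation `λ⊞_pre^{TB⊞} ⟶ k∼ ∘ G` across an orientation-reversing endomorphism**: along the lift
`φ` of `f`, `B″` is rescaled by `+1` on the `TB⊞`-leg and by `σ(G_f) = ε_f = -1` on `k∼(G_f)`; a natural `η` would have
`a₂(η_𝕏) · 1 = (-1) · a₂(η_𝕏)`, i.e. `a₂(η_𝕏) = 0`. [cite: MochizukiAbsTopIII2015, Cor 5.10 (iv)(c) p.148] -/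
theorem isEmpty_natTrans_tilde :
    IsEmpty (lamSimPlus 𝔄 ⋙ HolTHPlusPair.toTBPlus 𝔄 ⋙ TBPlus.uliftFunctor.{u + 1} ⟶
      toEA 𝔄 ⋙ 𝔄.toTMMono ⋙ TMMono.kTilde) := by
  refine ⟨fun θ => ?_⟩
  obtain ⟨φ, hφ⟩ := exists_endo_over x f
  subst hφ
  have hn := congrArg TBPlus.Hom.a₂ (θ.naturality φ)
  rw [TBPlus.comp_a₂, TBPlus.comp_a₂] at hn
  have h0 : ((lamSimPlus 𝔄 ⋙ HolTHPlusPair.toTBPlus 𝔄 ⋙ TBPlus.uliftFunctor.{u + 1}).map φ).a₂ = 1 := rfl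
  have h1 : ((toEA 𝔄 ⋙ 𝔄.toTMMono ⋙ TMMono.kTilde).map φ).a₂ = TMMono.sign (𝔄.toTMMono.map φ.base) := rfl
  rw [h0, h1, 𝔄.sign_toTMMono_map_eq_transitionSign, hf] at hn
  exact TBPlus.Hom.a₂_ne_zero (θ.app x) (by linarith)

/-- ★ The same in the other direction: no natural `k∼ ∘ G ⟶ λ⊞_pre^{TB⊞}`. [cite: MochizukiAbsTopIII2015, Cor 5.10 (iv)(c) p.148] -/
theorem isEmpty_natTrans_tilde_symm :
    IsEmpty (toEA 𝔄 ⋙ 𝔄.toTMMono ⋙ TMMono.kTilde ⟶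
      lamSimPlus 𝔄 ⋙ HolTHPlusPair.toTBPlus 𝔄 ⋙ TBPlus.uliftFunctor.{u + 1}) := by
  refine ⟨fun θ => ?_⟩
  obtain ⟨φ, hφ⟩ := exists_endo_over x f
  subst hφ
  have hn := congrArg TBPlus.Hom.a₂ (θ.naturality φ)
  rw [TBPlus.comp_a₂, TBPlus.comp_a₂] at hn
  have h0 : ((lamSimPlus 𝔄 ⋙ HolTHPlusPair.toTBPlus 𝔄 ⋙ TBPlus.uliftFunctor.{u + 1}).map φ).a₂ = 1 := rfl
  have h1 : ((toEA 𝔄 ⋙ 𝔄.toTMMono ⋙ TMMono.kTilde).map φ).a₂ = TMMono.sign (𝔄.toTMMono.map φ.base) := rfl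
  rw [h0, h1, 𝔄.sign_toTMMono_map_eq_transitionSign, hf] at hn
  exact TBPlus.Hom.a₂_ne_zero (θ.app x) (by linarith)

/-- ★ **No natural transformation `λ⊞_mult^{TB⊞} ⟶ k× ∘ G` across an orientation-reversing endomorphism.**
[cite: MochizukiAbsTopIII2015, Cor 5.10 (iv)(c) p.148] -/
theorem isEmpty_natTrans_times :
    IsEmpty (lamTimesPlus 𝔄 ⋙ HolTHPlusPair.toTBPlus 𝔄 ⋙ TBPlus.uliftFunctor.{u + 1} ⟶
      toEA 𝔄 ⋙ 𝔄.toTMMono ⋙ TMMono.kTimes) := by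
  refine ⟨fun θ => ?_⟩
  obtain ⟨φ, hφ⟩ := exists_endo_over x f
  subst hφ
  have hn := congrArg TBPlus.Hom.a₂ (θ.naturality φ)
  rw [TBPlus.comp_a₂, TBPlus.comp_a₂] at hn
  have h0 : ((lamTimesPlus 𝔄 ⋙ HolTHPlusPair.toTBPlus 𝔄 ⋙ TBPlus.uliftFunctor.{u + 1}).map φ).a₂ = 1 := rfl
  have h1 : ((toEA 𝔄 ⋙ 𝔄.toTMMono ⋙ TMMono.kTimes).map φ).a₂ = TMMono.sign (𝔄.toTMMono.map φ.base) := rfl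
  rw [h0, h1, 𝔄.sign_toTMMono_map_eq_transitionSign, hf] at hn
  exact TBPlus.Hom.a₂_ne_zero (θ.app x) (by linarith)

/-- ★ … and none `k× ∘ G ⟶ λ⊞_mult^{TB⊞}`. [cite: MochizukiAbsTopIII2015, Cor 5.10 (iv)(c) p.148] -/
theorem isEmpty_natTrans_times_symm :
    IsEmpty (toEA 𝔄 ⋙ 𝔄.toTMMono ⋙ TMMono.kTimes ⟶
      lamTimesPlus 𝔄 ⋙ HolTHPlusPair.toTBPlus 𝔄 ⋙ TBPlus.uliftFunctor.{u + 1}) := by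
  refine ⟨fun θ => ?_⟩
  obtain ⟨φ, hφ⟩ := exists_endo_over x f
  subst hφ
  have hn := congrArg TBPlus.Hom.a₂ (θ.naturality φ)
  rw [TBPlus.comp_a₂, TBPlus.comp_a₂] at hn
  have h0 : ((lamTimesPlus 𝔄 ⋙ HolTHPlusPair.toTBPlus 𝔄 ⋙ TBPlus.uliftFunctor.{u + 1}).map φ).a₂ = 1 := rfl
  have h1 : ((toEA 𝔄 ⋙ 𝔄.toTMMono ⋙ TMMono.kTimes).map φ).a₂ = TMMono.sign (𝔄.toTMMono.map φ.base) := rfl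
  rw [h0, h1, 𝔄.sign_toTMMono_map_eq_transitionSign, hf] at hn
  exact TBPlus.Hom.a₂_ne_zero (θ.app x) (by linarith)

/-- Hence no natural ISOMORPHISM `η⊢_{v,pre}` (either orientation). [cite: MochizukiAbsTopIII2015, Cor 5.10 (iv)(c) p.148] -/
theorem isEmpty_iso_tilde :
    IsEmpty (lamSimPlus 𝔄 ⋙ HolTHPlusPair.toTBPlus 𝔄 ⋙ TBPlus.uliftFunctor.{u + 1} ≅
      toEA 𝔄 ⋙ 𝔄.toTMMono ⋙ TMMono.kTilde) :=
  ⟨fun e => (isEmpty_natTrans_tilde x f hf).false e.hom⟩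

/-- Hence no natural ISOMORPHISM `η⊢_{v,mult}`. [cite: MochizukiAbsTopIII2015, Cor 5.10 (iv)(c) p.148] -/
theorem isEmpty_iso_times :
    IsEmpty (lamTimesPlus 𝔄 ⋙ HolTHPlusPair.toTBPlus 𝔄 ⋙ TBPlus.uliftFunctor.{u + 1} ≅
      toEA 𝔄 ⋙ 𝔄.toTMMono ⋙ TMMono.kTimes) :=
  ⟨fun e => (isEmpty_natTrans_times x f hf).false e.hom⟩

end NoGo

end HolTFPair

/-! ## §4. Instance: the print-faithful RC-holomorphic geometric `EA` -/

namespace HolRS.RC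

open AutHolFieldFunctor

/-- **An RC-holomorphic endomorphism with `𝒜_f = conj` has transition sign `-1`**: its transition automorphism
`e_𝕏 ∘ conj ∘ e_𝕏⁻¹` sends `i ↦ -i` whichever of `id`, `conj` the chosen chart `e_𝕏` is. [cite: MochizukiAbsTopIII2015, Rmk 5.8.1 (i) p.142] -/
theorem transitionSign_eq_neg_one (Q : ObjectProperty RC) {X : (geometricAutHolFieldFunctorRC Q).EA} (f : X ⟶ X)
    (hf : RC.fieldIso f.hom = starRingAut) : transitionSign f = -1 := by
  let 𝔄 := geometricAutHolFieldFunctorRC Q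
  -- the chosen chart commutes with complex conjugation (it is `id` or `conj`, being continuous)
  have key : ∀ z : ℂ, 𝔄.cafChart X (starRingEnd ℂ ((𝔄.cafChart X).symm z)) = starRingEnd ℂ z := by
    intro z
    have hw : (𝔄.cafChart X).symm (starRingEnd ℂ z) = starRingEnd ℂ ((𝔄.cafChart X).symm z) := by
      rcases Complex.ringHom_eq_id_or_conj_of_continuous (f := (𝔄.cafChart X).symm.toRingHom)
          (𝔄.continuous_cafChart_symm X) with h | h
      · have hs : ∀ w : ℂ, (𝔄.cafChart X).symm w = w := fun w => (RingHom.congr_fun h w : _)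
        rw [hs (starRingEnd ℂ z), hs z]
      · have hs : ∀ w : ℂ, (𝔄.cafChart X).symm w = starRingEnd ℂ w := fun w => (RingHom.congr_fun h w : _)
        rw [hs (starRingEnd ℂ z), hs z]
    rw [← hw, RingEquiv.apply_symm_apply]
  -- hence the transition automorphism sends `i ↦ -i`
  have hI : transition f I = -I := by
    change 𝔄.cafChart X (RC.fieldIso f.hom ((𝔄.cafChart X).symm I)) = -I
    rw [hf]
    change 𝔄.cafChart X (starRingEnd ℂ ((𝔄.cafChart X).symm I)) = -I
    rw [key, conj_I]
  unfold transitionSign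
  rw [if_neg]
  intro h
  have h2 : transition f I = I := (RingHom.congr_fun h I : _)
  have h3 := congrArg Complex.im (h2.symm.trans hI)
  norm_num at h3

/-- ★★ **At the print-faithful RC-holomorphic geometric `EA`, the archimedean `η⊢_{v,pre}` and `η⊢_{v,mult}` do NOT
exist as natural transformations** (either direction), as soon as the object class `Q` admits a Riemann surface with an
ANTI-holomorphic finite étale endomorphism (`𝒜 = conj`). [cite: MochizukiAbsTopIII2015, Cor 5.10 (iv)(c) p.148] -/
theorem isEmpty_eta_natTrans (Q : ObjectProperty RC) (X₀ : RC) (hX₀ : Q X₀) (g : X₀ ⟶ X₀)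
    (hg : RC.fieldIso g = starRingAut) :
    IsEmpty (HolTFPair.lamSimPlus (geometricAutHolFieldFunctorRC Q) ⋙
        HolTHPlusPair.toTBPlus (geometricAutHolFieldFunctorRC Q) ⋙ TBPlus.uliftFunctor.{1} ⟶
      HolTFPair.toEA (geometricAutHolFieldFunctorRC Q) ⋙ (geometricAutHolFieldFunctorRC Q).toTMMono ⋙ TMMono.kTilde) ∧
    IsEmpty (HolTFPair.toEA (geometricAutHolFieldFunctorRC Q) ⋙ (geometricAutHolFieldFunctorRC Q).toTMMono ⋙ TMMono.kTilde ⟶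
      HolTFPair.lamSimPlus (geometricAutHolFieldFunctorRC Q) ⋙
        HolTHPlusPair.toTBPlus (geometricAutHolFieldFunctorRC Q) ⋙ TBPlus.uliftFunctor.{1}) ∧
    IsEmpty (HolTFPair.lamTimesPlus (geometricAutHolFieldFunctorRC Q) ⋙
        HolTHPlusPair.toTBPlus (geometricAutHolFieldFunctorRC Q) ⋙ TBPlus.uliftFunctor.{1} ⟶
      HolTFPair.toEA (geometricAutHolFieldFunctorRC Q) ⋙ (geometricAutHolFieldFunctorRC Q).toTMMono ⋙ TMMono.kTimes) ∧
    IsEmpty (HolTFPair.toEA (geometricAutHolFieldFunctorRC Q) ⋙ (geometricAutHolFieldFunctorRC Q).toTMMono ⋙ TMMono.kTimes ⟶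
      HolTFPair.lamTimesPlus (geometricAutHolFieldFunctorRC Q) ⋙
        HolTHPlusPair.toTBPlus (geometricAutHolFieldFunctorRC Q) ⋙ TBPlus.uliftFunctor.{1}) := by
  -- the `TF`-pair `(𝕏₀ ↶ ℂ)` (Kummer structure the identity of `𝒜_𝕏₀ = ℂ`)
  let x : HolTFPair (geometricAutHolFieldFunctorRC Q) :=
    { X := ⟨X₀, hX₀⟩, k := ℂ, isCAF := isCAF_complex, κ := RingEquiv.refl ℂ, continuous_κ := continuous_id,
      continuous_κ_symm := continuous_id }
  let f : x.X ⟶ x.X := ObjectProperty.homMk g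
  have hf : transitionSign f = -1 := transitionSign_eq_neg_one Q f hg
  exact ⟨HolTFPair.isEmpty_natTrans_tilde x f hf, HolTFPair.isEmpty_natTrans_tilde_symm x f hf,
    HolTFPair.isEmpty_natTrans_times x f hf, HolTFPair.isEmpty_natTrans_times_symm x f hf⟩

/-- ★★ **Concretely: with the complex plane in `Q`** (complex conjugation is an anti-holomorphic automorphism of the
plane with `𝒜 = conj`, `RC.exists_antihol_aut_complexPlane`) there is no natural `η⊢_{v,pre}`.
[cite: MochizukiAbsTopIII2015, Cor 5.10 (iv)(c) p.148] -/
theorem isEmpty_etaTilde_iso_of_complexPlane (Q : ObjectProperty RC) (hQ : Q ⟨complexPlane⟩) :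
    IsEmpty (HolTFPair.lamSimPlus (geometricAutHolFieldFunctorRC Q) ⋙
        HolTHPlusPair.toTBPlus (geometricAutHolFieldFunctorRC Q) ⋙ TBPlus.uliftFunctor.{1} ≅
      HolTFPair.toEA (geometricAutHolFieldFunctorRC Q) ⋙ (geometricAutHolFieldFunctorRC Q).toTMMono ⋙ TMMono.kTilde) := by
  obtain ⟨φ, -, hφ⟩ := RC.exists_antihol_aut_complexPlane
  obtain ⟨h, -, -, -⟩ := isEmpty_eta_natTrans Q ⟨complexPlane⟩ hQ φ.hom hφ
  exact ⟨fun e => h.false e.hom⟩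

/-- **Contrast** (by name): over the HOLOMORPHIC sub-model `geometricAutHolFieldFunctor Q'` the same `η⊢_{v,pre}` EXISTS
(`HolRS.nonempty_etaTilde_geometric`) — naturality of the archimedean `η⊢` holds exactly on the orientation-coherent part
of `EA`. [cite: MochizukiAbsTopIII2015, Cor 5.10 (iv)(c) p.148] -/
theorem nonempty_etaTilde_holomorphic_and_isEmpty_rc (Q' : ObjectProperty HolRS) (Q : ObjectProperty RC)
    (hQ : Q ⟨complexPlane⟩) :
    Nonempty (HolTFPair.lamSimPlus (geometricAutHolFieldFunctor Q') ⋙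
        HolTHPlusPair.toTBPlus (geometricAutHolFieldFunctor Q') ⋙ TBPlus.uliftFunctor.{1} ≅
      HolTFPair.toEA (geometricAutHolFieldFunctor Q') ⋙ (geometricAutHolFieldFunctor Q').toTMMono ⋙ TMMono.kTilde) ∧
    IsEmpty (HolTFPair.lamSimPlus (geometricAutHolFieldFunctorRC Q) ⋙
        HolTHPlusPair.toTBPlus (geometricAutHolFieldFunctorRC Q) ⋙ TBPlus.uliftFunctor.{1} ≅
      HolTFPair.toEA (geometricAutHolFieldFunctorRC Q) ⋙ (geometricAutHolFieldFunctorRC Q).toTMMono ⋙ TMMono.kTilde) :=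
  ⟨HolRS.nonempty_etaTilde_geometric Q', isEmpty_etaTilde_iso_of_complexPlane Q hQ⟩

end HolRS.RC

end Literature.AnabelianGeometry.AbsoluteAnabelian
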